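import Summits.SmoothPoincare4.SmoothPoincare4.Theorems.EntropyRungCompactShrinkerGapScalarIdentities
import Literature.Geometry.Riemannian.GradientShrinkerProofs
import Literature.Geometry.Riemannian.BakryEmeryHeatFlow
import Literature.Geometry.Lorentzian.RicciNormSq
import Literature.Geometry.Lorentzian.MetricNormSq
import HarnessLib

/-!
# `∫ R e^{-f} dV = 2 ∫ |Ric|² e^{-f} dV` on a closed four-dimensional gradient shrinker
(helper for line `cgy-variance-pivot`, crux `EntropyRung.CompactShrinkerGap`, item stmt-SmoothPoincare4-10870;
this is the typed prover input W2 `WeightedScalarIdentity` of `Cruxes/CompactShrinkerGap/Disproof.lean` §18,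
stated WITHOUT the normalisation hypothesis, which it does not need)

For a Riemannian metric `g` (Levi-Civita connection) on a closed `4`-manifold and a smooth `f` with
`Ric + Hess f = g/2`: `∫_M R e^{-f} dV_g = 2 ∫_M |Ric|²_g e^{-f} dV_g`
(`|Ric|² = R_{ij}R^{ij}` is the metric square norm `normSq`).

* `weightedScalar_of_identityB` — the identity GIVEN (B) `ΔR = g⁻¹(dR, df) + R − 2|Ric|²` as a hypothesis:
  (B) says `Δ_f R := ΔR − g⁻¹(df, dR) = R − 2|Ric|²` for the drift Laplacian, and the weighted Green
  identity `∫ (ΔR − g⁻¹(df, dR)) e^{-f} dV = 0` (`integral_weightedLaplacian_eq_zero`, Carrillo–Ni's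
  conservation of mass for `dm = e^{-f}dV`) integrates it to `∫ (R − 2|Ric|²) e^{-f} dV = 0`.
* `weightedScalarIdentity` — the same with (B) discharged by the landed `Theorems.stub_shrinkerScalarIdentities`
  (p71473), so that only `Ric + Hess f = g/2` is assumed.

Consequences used by the line (paper): with the trace bound `R² ≤ 4|Ric|²` (landed p77783)
`∫(R − R²/2)e^{-f} ≥ 0`, and keeping `2|E|² = 2|Ric|² − R²/2` one gets the LP input W2′ of Disproof §17,
`∫(R − R²/2)e^{-f} = 2∫|E|²e^{-f} ≥ ½e^{-sup f}∫(R − 2)² dV`. Check: round `S⁴(√6)` (`R ≡ 2`, `|Ric|² ≡ 1`):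
`2e^{-2}V = 2e^{-2}V`. Everything is proved; no definition, no named fact.

References: H.-D. Cao, M. Zhu, arXiv:1008.0842, (3.6)–(3.7) [CaoZhu2010]; X. Cheng, E. Ribeiro Jr, D. Zhou,
arXiv:2203.14916, Lemma 1 [ChengRibeiroZhou2022]; J. A. Carrillo, L. Ni, Comm. Anal. Geom. 17 (2009), §3 (3.1)–(3.2)
[CarrilloNi2009].
-/

noncomputable section

-- the registered namespace `Summit.SmoothPoincare4.SmoothPoincare4.Theorems` repeats a component
set_option linter.dupNamespace false

open Bundle Set Function Filter Module MeasureTheory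
open scoped Manifold ContDiff Topology

namespace Summit.SmoothPoincare4.SmoothPoincare4.Theorems

open Literature.Geometry Literature.Geometry.Lorentzian Literature.Geometry.Riemannian
  Literature.Geometry.Lorentzian.PseudoRiemannianMetric

/-- **Weighted scalar-curvature identity, from (B)**: on a closed 4-manifold with Riemannian `g` (Levi-Civita) and
smooth `f`, GIVEN (B) `ΔR = g⁻¹(dR, df) + R − 2|Ric|²` for this `(g, f)`, one has `∫ R e^{-f} dV = 2∫|Ric|² e^{-f} dV`:
the weighted Green identity `∫ (ΔR − g⁻¹(df, dR)) e^{-f} dV = 0` (`integral_weightedLaplacian_eq_zero`) and (B)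
give `∫ (R − 2|Ric|²) e^{-f} = 0` (every integrand is continuous on the compact `M`; `riemVolume_eq`). The soliton
equation itself is not used here (it is what makes (B) true). [cite: CaoZhu2010, (3.6)–(3.7)]
[cite: CarrilloNi2009, §3 (3.1)–(3.2)] -/
theorem weightedScalar_of_identityB
    (M : Type) [TopologicalSpace M] [T2Space M] [SecondCountableTopology M]
    [ChartedSpace (EuclideanSpace ℝ (Fin 4)) M] [IsManifold (𝓡 4) ∞ M] [CompactSpace M]
    [T3Space M] [MeasurableSpace M] [BorelSpace M]
    (g : Literature.Geometry.Lorentzian.PseudoRiemannianMetric (𝓡 4) ∞ (EuclideanSpace ℝ (Fin 4))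
      (TangentSpace (𝓡 4) : M → Type _)) [g.HasLeviCivita] (f : M → ℝ) (hg : g.IsRiemannian)
    (hf : ContMDiff (𝓡 4) 𝓘(ℝ, ℝ) ∞ f)
    (hB : ∀ x : M, g.dalembertian g.scalarCurvature x =
      g.innerDual x (mvfderiv (𝓡 4) g.scalarCurvature x : TangentSpace (𝓡 4) x →ₗ[ℝ] ℝ)
          (mvfderiv (𝓡 4) f x : TangentSpace (𝓡 4) x →ₗ[ℝ] ℝ) +
        g.scalarCurvature x - 2 * g.normSq x (g.ricci x)) :
    ∫ x, g.scalarCurvature x * Real.exp (-f x)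
        ∂(Literature.Geometry.Lorentzian.riemannianMeasure (g.toContMDiffRiemannianMetric hg)) =
      2 * ∫ x, g.normSq x (g.ricci x) * Real.exp (-f x)
        ∂(Literature.Geometry.Lorentzian.riemannianMeasure (g.toContMDiffRiemannianMetric hg)) := by
  -- the Riemannian measure is `g.riemVolume`
  have hV : g.riemVolume = riemannianMeasure (g.toContMDiffRiemannianMetric hg) :=
    PseudoRiemannianMetric.riemVolume_eq hg
  rw [← hV]
  -- regularity of `R` and `f`
  have hR : ContMDiff (𝓡 4) 𝓘(ℝ, ℝ) ∞ g.scalarCurvature := g.contMDiff_scalarCurvature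
  have hR2 : ContMDiff (𝓡 4) 𝓘(ℝ, ℝ) 2 g.scalarCurvature :=
    hR.of_le (WithTop.coe_le_coe.mpr le_top)
  have hf1 : ContMDiff (𝓡 4) 𝓘(ℝ, ℝ) 1 f := hf.of_le (by norm_num)
  -- continuity, hence integrability, of the two integrands
  have hRc : Continuous g.scalarCurvature := hR.continuous
  have hQc : Continuous fun x ↦ g.normSq x (g.ricci x) := g.contMDiff_normSq_ricci'.continuous
  have hec : Continuous fun x ↦ Real.exp (-f x) := Real.continuous_exp.comp hf.continuous.neg
  have iRe : Integrable (fun x ↦ g.scalarCurvature x * Real.exp (-f x)) g.riemVolume :=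
    g.integrable_of_continuous (hRc.mul hec)
  have iQe : Integrable (fun x ↦ g.normSq x (g.ricci x) * Real.exp (-f x)) g.riemVolume :=
    g.integrable_of_continuous (hQc.mul hec)
  -- the weighted Green identity `∫ (ΔR − g⁻¹(df, dR)) e^{-f} = 0`, rewritten through (B)
  have h0 := integral_weightedLaplacian_eq_zero g hg hR2 hf1
  have hpt : ∀ x, (g.dalembertian g.scalarCurvature x -
      g.innerDual x (mvfderiv (𝓡 4) f x : TangentSpace (𝓡 4) x →ₗ[ℝ] ℝ)
        (mvfderiv (𝓡 4) g.scalarCurvature x : TangentSpace (𝓡 4) x →ₗ[ℝ] ℝ)) *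
        Real.exp (-f x) =
      g.scalarCurvature x * Real.exp (-f x) -
        2 * (g.normSq x (g.ricci x) * Real.exp (-f x)) := fun x ↦ by
    rw [hB x, g.innerDual_comm x (mvfderiv (𝓡 4) f x : TangentSpace (𝓡 4) x →ₗ[ℝ] ℝ)]
    ring
  have h1 : ∫ x, (g.scalarCurvature x * Real.exp (-f x) -
      2 * (g.normSq x (g.ricci x) * Real.exp (-f x))) ∂g.riemVolume = 0 := by
    rw [← h0]
    exact integral_congr_ae (ae_of_all _ fun x ↦ (hpt x).symm)
  rw [integral_sub iRe (iQe.const_mul 2), integral_const_mul] at h1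
  linarith

/-- **Weighted scalar-curvature identity of a closed gradient shrinker** (`Ric + Hess f = g/2`, `f` smooth, `g`
Riemannian with Levi-Civita connection, closed 4-manifold): `∫ R e^{-f} dV = 2∫|Ric|² e^{-f} dV` — (B) from the
landed `Theorems.stub_shrinkerScalarIdentities`, then `weightedScalar_of_identityB`. This is the prover input W2 of
`Disproof.lean` §18 (there stated with the unused extra hypothesis `R + |∇f|² = f`). With `R² ≤ 4|Ric|²` it gives
`∫(R − R²/2)e^{-f} dV ≥ 0`, i.e. `2∫|E|²e^{-f} = ∫(R − R²/2)e^{-f}`. [cite: CaoZhu2010, (3.6)–(3.7)]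
[cite: ChengRibeiroZhou2022, Lemma 1] -/
theorem weightedScalarIdentity :
    ∀ (M : Type) [TopologicalSpace M] [T2Space M] [SecondCountableTopology M]
      [ChartedSpace (EuclideanSpace ℝ (Fin 4)) M] [IsManifold (𝓡 4) ∞ M] [CompactSpace M]
      [T3Space M] [MeasurableSpace M] [BorelSpace M]
      (g : Literature.Geometry.Lorentzian.PseudoRiemannianMetric (𝓡 4) ∞ (EuclideanSpace ℝ (Fin 4))
        (TangentSpace (𝓡 4) : M → Type _)) [g.HasLeviCivita] (f : M → ℝ) (hg : g.IsRiemannian),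
      ContMDiff (𝓡 4) 𝓘(ℝ, ℝ) ∞ f →
      (∀ (x : M) (X Y : TangentSpace (𝓡 4) x),
        g.ricci x X Y + g.hessian f x X Y = (1 / 2 : ℝ) * g.val x X Y) →
      ∫ x, g.scalarCurvature x * Real.exp (-f x)
          ∂(Literature.Geometry.Lorentzian.riemannianMeasure (g.toContMDiffRiemannianMetric hg)) =
        2 * ∫ x, g.normSq x (g.ricci x) * Real.exp (-f x)
          ∂(Literature.Geometry.Lorentzian.riemannianMeasure (g.toContMDiffRiemannianMetric hg)) := by
  intro M _ _ _ _ _ _ _ _ _ g _ f hg hf hsol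
  obtain ⟨_, hB⟩ := stub_shrinkerScalarIdentities M g f hg hf hsol
  exact weightedScalar_of_identityB M g f hg hf hB

end Summit.SmoothPoincare4.SmoothPoincare4.Theorems

end
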